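import Literature.NumberTheory.GaloisRepresentations.TameInertiaKummerProofs
import Mathlib.GroupTheory.FiniteAbelian.Duality
import HarnessLib

/-!
# Frobenius conjugation acts on the tame homomorphisms `I_F → B` as multiplication by `q`
# (Serre, *Propriétés galoisiennes*, §1.7 Prop. 5 and §1.8 Prop. 6; theorems only)

Topic `NumberTheory/GaloisRepresentations`; namespace `Literature.NumberTheory.GaloisRepresentations`.
THEOREMS ONLY (no definition, no named fact; D-0026).

Let `F` be a non-archimedean local field with residue field of characteristic `p` and order `q`,
`I_F = absInertia F` its inertia group, and `B` a finite abelian group of order prime to `p` (with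
the discrete topology). A continuous homomorphism `f : I_F → B` factors through the tame quotient
`I_t = I_F / I_p ≅ lim← μ_d` (its image is cyclic of order prime to `p`), on which conjugation by a
Frobenius power `τ` (`IsFrobPow τ m`: `τ` acts on the residue ring as `x ↦ x^{q^m}`) is
`u ↦ u^{q^m}` (Serre 1972, §1.8 Prop. 6: "`s u s⁻¹ ≡ u^p (mod I_p)`"). Hence

* `apply_conj_eq_pow_nsmul_of_isFrobPow` — **`f(τ σ τ⁻¹) = q^m · f(σ)`** for every `σ ∈ I_F`;
* `apply_frob_conj_eq_card_nsmul` — the case of an arithmetic Frobenius (`m = 1`).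

Proof: by duality for the finite abelian group `B` (Mathlib
`CommGroup.forall_apply_eq_apply_iff`: characters into `kˣ` separate points when `k` has enough
`e`-th roots of unity, `e` the exponent of `B`, prime to `p` — here `k = ℤ̄_F/𝔓`, the residue field
of the integral closure, `exists_isPrimitiveRoot_of_not_dvd`), it suffices to check the identity
after composing with any character `χ : B → kˣ`; the continuous character `χ ∘ f` of `I_F` has
exponent `e`, hence is a power of the Kummer character `θ_e` (the tree's discharged fact
`exists_eq_kummerCharacter_pow_holds`, Serre §1.7 Prop. 5), and `θ_e(τστ⁻¹) = θ_e(σ)^{q^m}`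
(`kummerCharacter_conj_apply`, Serre §1.8 Prop. 6).

Consumers (cell `b2b-bsdres`, Greenberg–Vatsal §2 Prop. (2.4) in the kernel): for a `p`-adic Galois
module `A` on which `I_v` (`v ∤ p`) acts trivially, `H¹(I_v, A) = Hom_cont(I_v, A)` carries the
conjugation action of the decomposition group, which this file computes: `A(-1)`-twisted.

## References

* [SerreInventiones1972] J.-P. Serre, *Propriétés galoisiennes des points d'ordre fini des courbes
  elliptiques*, Invent. Math. 15 (1972), §1.3, §1.7 Prop. 5, §1.8 Prop. 6.
* [SerreLocalFields1979] J.-P. Serre, *Local Fields*, GTM 67 (1979), Ch. IV §2.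
-/

noncomputable section

open scoped Pointwise Valued
open Field ValuativeRel

universe u

namespace Literature.NumberTheory.GaloisRepresentations

open GaloisRepresentations.IsNonarchimedeanLocalField

variable (F : Type u) [Field F] [ValuativeRel F] [TopologicalSpace F] [IsNonarchimedeanLocalField F]

/-- **Frobenius conjugation multiplies tame homomorphisms by `q^m`.** Let `B` be a finite abelian
group of order prime to the residue characteristic `p` of `F`, with the discrete topology, and
`f : I_F → B` a continuous homomorphism. If `τ ∈ Γ_F` is a Frobenius power of exponent `m`
(`IsFrobPow τ m`) then `f(τ σ τ⁻¹) = q^m • f(σ)` for every `σ ∈ I_F` (`q = residueFieldCard F`).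
(Serre 1972, §1.8 Prop. 6: conjugation by a Frobenius acts on `I_t = I/I_p` by `u ↦ u^q`; §1.7
Prop. 5: the continuous characters of `I_t` of exponent `e` prime to `p` are the powers of `θ_e`.)
Proof: test against every character `χ : B → kˣ`, `k = ℤ̄_F/𝔓` (which has enough `e`-th roots of
unity, `e` the exponent of `B`; Mathlib `CommGroup.forall_apply_eq_apply_iff`); `χ ∘ f = θ_e^a`
(`exists_eq_kummerCharacter_pow_holds`) and `θ_e(τστ⁻¹) = θ_e(σ)^{q^m}` (`kummerCharacter_conj_apply`).
[cite: SerreInventiones1972, §1.7 Prop. 5 and §1.8 Prop. 6] -/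
theorem apply_conj_eq_pow_nsmul_of_isFrobPow
    {B : Type*} [AddCommGroup B] [Finite B] [TopologicalSpace B] [DiscreteTopology B]
    (hB : (Nat.card B).Coprime (ringChar 𝓀[F]))
    (f : absInertia F → B) (hf : ∀ x y, f (x * y) = f x + f y) (hfc : Continuous f)
    {τ : absoluteGaloisGroup F} {m : ℕ} (hτ : IsFrobPow τ m) (σ : absInertia F)
    (hconj : τ * (σ : absoluteGaloisGroup F) * τ⁻¹ ∈ absInertia F) :
    f ⟨τ * σ * τ⁻¹, hconj⟩ = (residueFieldCard F ^ m) • f σ := by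
  classical
  -- coefficient field: the residue field `k = ℤ̄_F ⧸ 𝔓`, with the discrete topology
  haveI : (absMaximalIdeal F).IsMaximal := absMaximalIdeal_isMaximal_holds F
  letI : Field (absIntegers 𝒪[F] F ⧸ absMaximalIdeal F) := Ideal.Quotient.field _
  letI : TopologicalSpace (absIntegers 𝒪[F] F ⧸ absMaximalIdeal F) := ⊥
  haveI : DiscreteTopology (absIntegers 𝒪[F] F ⧸ absMaximalIdeal F) := ⟨rfl⟩
  -- `f` as a homomorphism `g : I_F →* Multiplicative B`
  have hf1 : f 1 = 0 := by
    have h := hf 1 1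
    rw [mul_one] at h
    exact left_eq_add.mp h
  let g : absInertia F →* Multiplicative B :=
    { toFun := fun x => Multiplicative.ofAdd (f x)
      map_one' := by rw [hf1]; rfl
      map_mul' := fun x y => by rw [hf x y]; rfl }
  have hg : ∀ x, g x = Multiplicative.ofAdd (f x) := fun _ => rfl
  have hgc : Continuous g := continuous_ofAdd.comp hfc
  -- the exponent `e` of `B` is prime to `p`
  set e : ℕ := Monoid.exponent (Multiplicative B) with he_def
  have he0 : e ≠ 0 := Monoid.exponent_ne_zero_of_finite
  have he : 0 < e := Nat.pos_of_ne_zero he0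
  have hedvd : e ∣ Nat.card B := Group.exponent_dvd_nat_card (G := Multiplicative B)
  have hpe : ¬ ringChar 𝓀[F] ∣ e := by
    intro h
    have hp : (ringChar 𝓀[F]).Prime := ringChar_residueField_prime (F := F)
    have h1 : ringChar 𝓀[F] ∣ Nat.card B := h.trans hedvd
    have h2 : Nat.gcd (Nat.card B) (ringChar 𝓀[F]) = 1 := hB
    have h3 : ringChar 𝓀[F] ∣ Nat.gcd (Nat.card B) (ringChar 𝓀[F]) := Nat.dvd_gcd h1 dvd_rfl
    rw [h2] at h3
    exact hp.one_lt.ne' (Nat.dvd_one.mp h3)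
  -- `k` has enough `e`-th roots of unity, so characters into `kˣ` separate points of `B`
  obtain ⟨ζ, hζ⟩ := exists_isPrimitiveRoot_of_not_dvd (F := F)
    (k := absIntegers 𝒪[F] F ⧸ absMaximalIdeal F) (RingHom.id _) he hpe
  haveI : HasEnoughRootsOfUnity (absIntegers 𝒪[F] F ⧸ absMaximalIdeal F)
      (Monoid.exponent (Multiplicative B)) := ⟨⟨ζ, hζ⟩, inferInstance⟩
  -- it suffices to test against every character `χ`
  suffices key : ∀ χ : Multiplicative B →* (absIntegers 𝒪[F] F ⧸ absMaximalIdeal F)ˣ,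
      χ (g ⟨τ * σ * τ⁻¹, hconj⟩) = χ (g σ ^ (residueFieldCard F ^ m)) by
    have h := (CommGroup.forall_apply_eq_apply_iff (G := Multiplicative B)
      (M := absIntegers 𝒪[F] F ⧸ absMaximalIdeal F)).mp key
    have h' := congrArg Multiplicative.toAdd h
    rw [hg, hg, toAdd_ofAdd, toAdd_pow, toAdd_ofAdd] at h'
    exact h'
  intro χ
  -- `ψ = χ ∘ g` is a continuous character of exponent `e`
  set ψ : absInertia F →* (absIntegers 𝒪[F] F ⧸ absMaximalIdeal F)ˣ := χ.comp g with hψ_def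
  have hψc : Continuous ψ := (continuous_of_discreteTopology (f := χ)).comp hgc
  have hψe : ∀ x, ψ x ^ e = 1 := fun x => by
    rw [hψ_def, MonoidHom.comp_apply, ← map_pow, Monoid.pow_exponent_eq_one, map_one]
  -- a uniformiser, and the classification of exponent-`e` characters of `I_F`
  obtain ⟨ϖ, hϖ⟩ := IsDiscreteValuationRing.exists_irreducible 𝒪[F]
  obtain ⟨a, ha⟩ := exists_eq_kummerCharacter_pow_holds F (absIntegers 𝒪[F] F ⧸ absMaximalIdeal F)
    (RingHom.id _) he hpe hϖ ψ hψc hψe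
  -- conjugation by `τ` multiplies the Kummer character by `q^m`
  have hconj' := kummerCharacter_conj_apply he hϖ.ne_zero
    (RingHom.id (absIntegers 𝒪[F] F ⧸ absMaximalIdeal F)) hτ σ hconj
  have hψval : ψ ⟨τ * σ * τ⁻¹, hconj⟩ = ψ σ ^ (residueFieldCard F ^ m) := by
    apply Units.ext
    rw [ha, MonoidHom.pow_apply, MonoidHom.pow_apply, Units.val_pow_eq_pow_val,
      Units.val_pow_eq_pow_val, Units.val_pow_eq_pow_val, hconj', ← pow_mul, ← pow_mul, mul_comm]
  have : χ (g ⟨τ * σ * τ⁻¹, hconj⟩) = ψ ⟨τ * σ * τ⁻¹, hconj⟩ := rfl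
  rw [this, hψval, hψ_def, MonoidHom.comp_apply, map_pow]

/-- **Conjugation by an arithmetic Frobenius multiplies tame homomorphisms by `q`**: for `B` a
finite abelian group of order prime to the residue characteristic, `f : I_F → B` a continuous
homomorphism and `φ` an (absolute) arithmetic Frobenius of `F`, `f(φ σ φ⁻¹) = q • f(σ)` for all
`σ ∈ I_F`. [cite: SerreInventiones1972, §1.8 Prop. 6] -/
theorem apply_frob_conj_eq_card_nsmul
    {B : Type*} [AddCommGroup B] [Finite B] [TopologicalSpace B] [DiscreteTopology B]
    (hB : (Nat.card B).Coprime (ringChar 𝓀[F]))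
    (f : absInertia F → B) (hf : ∀ x y, f (x * y) = f x + f y) (hfc : Continuous f)
    {φ : absoluteGaloisGroup F} (hφ : IsAbsArithFrob φ) (σ : absInertia F) :
    f ⟨φ * σ * φ⁻¹, (inferInstance : (absInertia F).Normal).conj_mem _ σ.2 φ⟩ =
      residueFieldCard F • f σ := by
  have h := apply_conj_eq_pow_nsmul_of_isFrobPow F hB f hf hfc (IsAbsArithFrob.isFrobPow_holds hφ) σ
    ((inferInstance : (absInertia F).Normal).conj_mem _ σ.2 φ)
  rw [pow_one] at h
  exact h

end Literature.NumberTheory.GaloisRepresentations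

end
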